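import Summits.AnomalousDissipation.AnomalousDissipation.Theorems.SolenoidalFractalHomogenisationLagrangianStepCellChainClassical
import Summits.AnomalousDissipation.AnomalousDissipation.Theorems.SolenoidalFractalHomogenisationLagrangianStepCellChainGap
import Summits.AnomalousDissipation.AnomalousDissipation.Theorems.SolenoidalFractalHomogenisationLagrangianStepCellChainSlotStepInputs
import Summits.AnomalousDissipation.AnomalousDissipation.Theorems.SolenoidalFractalHomogenisationLagrangianStepW7SlotAC
import Summits.AnomalousDissipation.AnomalousDissipation.Theorems.SolenoidalFractalHomogenisationLagrangianStepW7DrainFloor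
import HarnessLib

/-!
# K1L_D `LagrangianRenormalisationStepDesign` (stmt-AnomalousDissipation-27980), `stub_cellLawV0_IS` V0:
# the FAST ENERGY of a weak solution of the flat tensor cell problem off a finite slow block — a.e. balance and forced decay
# (helper; `--supports stmt-AnomalousDissipation-27980`)

Summits-side helper file of route `SolenoidalFractalHomogenisation` (prover seat `ad-k1l-cellLawV-w1` g5).  Everything proved; no definitions,
no named facts, no sorry.

SETTING.  `h : Torus.IsWeakTensorPassiveVectorOn 0 T 𝔹 (W₁.cell n) F u` (any lattice word `W₁`, any cell number `n`), a Legendre–Hadamard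
window `NearIso 𝔹 lo' hi'`, the energy representative `E, Q` of `…CellChainEnergy.exists_energyRep(_cell)` (only the conjuncts used are taken
as hypotheses: `E = ∫‖u‖²` a.e., the finite-block dissipation bounds `4π²Σ_{k∈S} Re⟪û_k, T_𝔹(k) û_k⟫ ≤ Q`, `E' = −2Q` a.e., absolute continuity),
a FINITE SLOW BLOCK `W` of modes, and a gap `dmin ≤ 8π²·lo'·|k|²` on every other mode the solution carries.  The FAST ENERGY is
`Z(t) := E t − Σ_{k∈W} ‖modeRep … k t‖²` (for a.e. `t` it is `Σ_{k∉W} ‖û(t)(k)‖²` by Parseval).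

* §1 `gronwall_ac_forced` — forced Grönwall for an absolutely continuous functional: a.e. `Φ' ≤ −σΦ + G` (`σ > 0`) on `[t₀,t₁]` gives
  `Φ t₁ ≤ G/σ + e^{−σ(t₁−t₀)}(Φ t₀ − G/σ)` (p5's `W7Engine.gronwall_ac_exp` applied to `Φ − G/σ`); `absolutelyContinuousOnInterval_finsetSum`.
* §2 `ae_hasDerivAt_fastEnergy_le` — for a.e. `t ∈ (0,T)`: `Z` has derivative `−2Q t − Σ_{k∈W} 2Re⟪y_k, rhs_k⟫` (`y_k = modeRep … k`, `rhs_k` the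
  representative chain right-hand side, classical by `…CellChainClassical.hasDerivAt_norm_sq_modeRep`), and THIS VALUE IS
  `≤ −dmin·Z t + X t` with the EXCHANGE `X t := Σ_{k∈W} 2Re⟪y_k, Σⱼ linkCoeffⱼ(k,t) • P_k(aⱼ y_{k−Kⱼ} + a′ⱼ y_{k+Kⱼ})⟫` (the block split
  `…CellChainPair.block_split_le` at the block `W`: the viscous part of the slow modes' own balance cancels against their share of `Q`; the skew
  transport inside the fast block never appears — it is invisible in `E`).
* §3 `fastEnergy_le_of_exchange_le` — if a.e. `X ≤ (dmin/2)·Z + G` then `Z t ≤ 2G/dmin + e^{−dmin t/2}(Z 0 − 2G/dmin)` on `[0,T]`.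
The exchange bound itself (`X ≤ (dmin/2)Z + (2/dmin)A²` from the slow amplitudes) and the packaged slaving estimates are in `…CellChainFastSlaving`.
NOT a proof of any registered stub, of the crux, or of anomalous dissipation; rung F-D1.A0 infrastructure.
-/

set_option linter.dupNamespace false

noncomputable section

namespace Summit.AnomalousDissipation.AnomalousDissipation.Theorems.SolenoidalFractalHomogenisation.LagrangianStep.CellChain

open Set MeasureTheory Filter Topology Function Complex UnitAddTorus
open scoped InnerProductSpace ComplexConjugate
open Literature.Analysis Literature.Analysis.FunctionSpaces Literature.Analysis.FunctionSpaces.Torus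
open Literature.Analysis.FluidPDE Literature.Analysis.FluidPDE.Torus Literature.Analysis.FluidPDE.LatticeShear
open Summit.AnomalousDissipation.AnomalousDissipation.Theorems.SolenoidalFractalHomogenisation.LagrangianStep.W7Engine (gronwall_ac_exp)

variable {k₀ : ℕ}

/-! ## §1 Forced Grönwall for an absolutely continuous functional -/

/-- **Forced Grönwall, absolutely continuous form.**  If `Φ` is absolutely continuous on `[t₀,t₁]` with a.e. derivative `φ ≤ −σΦ + G` there
(`σ > 0`), then `Φ t₁ ≤ G/σ + e^{−σ(t₁−t₀)}·(Φ t₀ − G/σ)`. [cite: BedrossianCotiZelati2017, §2] -/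
theorem gronwall_ac_forced {Φ φ : ℝ → ℝ} {t₀ t₁ σ G : ℝ} (ht : t₀ ≤ t₁) (hσ : 0 < σ)
    (hΦ : AbsolutelyContinuousOnInterval Φ t₀ t₁)
    (hΦd : ∀ᵐ t, t ∈ uIcc t₀ t₁ → HasDerivAt Φ (φ t) t)
    (hineq : ∀ᵐ t, t ∈ uIcc t₀ t₁ → φ t ≤ -σ * Φ t + G) :
    Φ t₁ ≤ G / σ + Real.exp (-(σ * (t₁ - t₀))) * (Φ t₀ - G / σ) := by
  have hconst : AbsolutelyContinuousOnInterval (fun _ : ℝ => G / σ) t₀ t₁ :=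
    ((LipschitzWith.const (G / σ)).lipschitzOnWith (s := uIcc t₀ t₁)).absolutelyContinuousOnInterval
  have hΨ : AbsolutelyContinuousOnInterval (fun t => Φ t - G / σ) t₀ t₁ := hΦ.sub hconst
  have hΨd : ∀ᵐ t, t ∈ uIcc t₀ t₁ → HasDerivAt (fun t => Φ t - G / σ) (φ t) t := by
    filter_upwards [hΦd] with t hd htI
    exact (hd htI).sub_const _
  have hineq' : ∀ᵐ t, t ∈ uIcc t₀ t₁ → φ t ≤ -σ * (Φ t - G / σ) := by
    filter_upwards [hineq] with t hle htI
    have h1 := hle htI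
    have h2 : -σ * (Φ t - G / σ) = -σ * Φ t + G := by field_simp; ring
    rw [h2]; exact h1
  have key := gronwall_ac_exp (σ := fun _ => σ) ht hΨ hΨd continuous_const hineq'
  rw [intervalIntegral.integral_const, smul_eq_mul] at key
  have hexp : Real.exp (-((t₁ - t₀) * σ)) = Real.exp (-(σ * (t₁ - t₀))) := by ring_nf
  rw [hexp] at key
  linarith

/-- The same with a nonnegative source and a nonnegative functional at the start: `Φ t₁ ≤ G/σ + e^{−σ(t₁−t₀)}·Φ t₀`. [cite: BedrossianCotiZelati2017, §2] -/
theorem gronwall_ac_forced' {Φ φ : ℝ → ℝ} {t₀ t₁ σ G : ℝ} (ht : t₀ ≤ t₁) (hσ : 0 < σ) (hG : 0 ≤ G)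
    (hΦ : AbsolutelyContinuousOnInterval Φ t₀ t₁)
    (hΦd : ∀ᵐ t, t ∈ uIcc t₀ t₁ → HasDerivAt Φ (φ t) t)
    (hineq : ∀ᵐ t, t ∈ uIcc t₀ t₁ → φ t ≤ -σ * Φ t + G) :
    Φ t₁ ≤ G / σ + Real.exp (-(σ * (t₁ - t₀))) * Φ t₀ := by
  have h := gronwall_ac_forced ht hσ hΦ hΦd hineq
  have h1 : 0 ≤ Real.exp (-(σ * (t₁ - t₀))) * (G / σ) := mul_nonneg (Real.exp_pos _).le (div_nonneg hG hσ.le)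
  nlinarith [h, h1]

/-! ## §2 The fast energy: a.e. derivative and the dissipation bound -/

/-- `‖P_k z‖ ≤ ‖z‖` (orthogonal projection). [cite: Temam1984, Ch. III §1.1] -/
theorem norm_transversalProj_le (K : Fin 3 → ℤ) (z : EuclideanSpace ℂ (Fin 3)) : ‖transversalProj K z‖ ≤ ‖z‖ := by
  have h := W7Slot.norm_sq_transversalProj K z
  have h1 : ‖transversalProj K z‖ ^ 2 ≤ ‖z‖ ^ 2 := by
    rw [h]
    have : 0 ≤ ‖kdot K z‖ ^ 2 / freqNormSq K := div_nonneg (sq_nonneg _) (freqNormSq_nonneg K)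
    linarith
  exact (pow_le_pow_iff_left₀ (norm_nonneg _) (norm_nonneg _) two_ne_zero).1 h1

/-- Finite sums of absolutely continuous functions are absolutely continuous. [folklore] -/
theorem absolutelyContinuousOnInterval_finsetSum {ι : Type*} (S : Finset ι) {f : ι → ℝ → ℝ} {a b : ℝ}
    (hf : ∀ i ∈ S, AbsolutelyContinuousOnInterval (f i) a b) :
    AbsolutelyContinuousOnInterval (fun t => ∑ i ∈ S, f i t) a b := by
  classical
  induction S using Finset.induction_on with
  | empty =>
    simp only [Finset.sum_empty]
    exact ((LipschitzWith.const (0:ℝ)).lipschitzOnWith (s := uIcc a b)).absolutelyContinuousOnInterval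
  | insert i S hi ih =>
    have h1 : AbsolutelyContinuousOnInterval (f i) a b := hf i (Finset.mem_insert_self i S)
    have h2 := ih fun j hj => hf j (Finset.mem_insert_of_mem hj)
    simp only [Finset.sum_insert hi]
    exact h1.fun_add h2

/-- **The fast energy: a.e. derivative and the dissipation bound.**  For a.e. `t ∈ (0,T)` the fast energy `Z = E − Σ_{k∈W}‖y_k‖²` is
differentiable with derivative `−2Q t − Σ_{k∈W} 2Re⟪y_k t, rhs_k t⟫`, and this value is at most `−dmin·Z t + X t`, `X` the exchange of the block with its
chain neighbours. [cite: BedrossianCotiZelati2017, §2 (hypocoercivity functional with a cross term)] [cite: Temam1984, Ch. III §1 Lemma 1.2] -/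
theorem ae_hasDerivAt_fastEnergy_le (W₁ : LatticeWord k₀) (n : ℕ) {T : ℝ} (hT : 0 ≤ T) {𝔹 : Torus.Visc4 (Fin 3)} {lo' hi' : ℝ}
    (h𝔹 : Torus.NearIso 𝔹 lo' hi')
    {F : UnitAddTorus (Fin 3) → EuclideanSpace ℝ (Fin 3)} {u : ℝ → UnitAddTorus (Fin 3) → EuclideanSpace ℝ (Fin 3)}
    (h : Torus.IsWeakTensorPassiveVectorOn 0 T 𝔹 (W₁.cell n) F u) (hF : Integrable F volume)
    {E Q : ℝ → ℝ} (hE : ∀ᵐ t ∂(volume.restrict (Ioo 0 T)), E t = ∫ x, ‖u t x‖ ^ 2)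
    (hQ : ∀ᵐ t ∂(volume.restrict (Ioo 0 T)), ∀ S : Finset (Fin 3 → ℤ),
      4 * Real.pi ^ 2 * ∑ k ∈ S, (⟪mFourierCoeff (EuclideanSpace.complexify ∘ u t) k,
        Torus.symbT 𝔹 k (mFourierCoeff (EuclideanSpace.complexify ∘ u t) k)⟫_ℂ).re ≤ Q t)
    (hEd : ∀ᵐ t ∂(volume : Measure ℝ), t ∈ Ioo 0 T → HasDerivAt E (-(2 * Q t)) t)
    (W : Finset (Fin 3 → ℤ)) {dmin : ℝ} (hdmin : 0 ≤ dmin)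
    (hgap : ∀ᵐ t ∂(volume.restrict (Ioo 0 T)), ∀ k : Fin 3 → ℤ, k ∉ W →
      mFourierCoeff (EuclideanSpace.complexify ∘ u t) k ≠ 0 → dmin ≤ 8 * Real.pi ^ 2 * lo' * freqNormSq k) :
    ∀ᵐ t ∂(volume : Measure ℝ), t ∈ Ioo 0 T →
      HasDerivAt (fun s => E s - ∑ k ∈ W, ‖modeRep W₁ n 𝔹 F u k s‖ ^ 2)
        (-(2 * Q t) - ∑ k ∈ W, 2 * (⟪modeRep W₁ n 𝔹 F u k t,
          (-(((4 * Real.pi ^ 2 : ℝ) : ℂ) • transversalProj k (Torus.symbT (Torus.majorTranspose 𝔹) k (modeRep W₁ n 𝔹 F u k t))) -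
          ∑ j, linkCoeff W₁ n k j t • transversalProj k
            ((Complex.exp ((W₁.phase j).φ * Complex.I) * (1 / (2 * ((2 * Real.pi * ‖latticeVec (W₁.phase j).m‖ : ℝ) : ℂ) * Complex.I))) •
                modeRep W₁ n 𝔹 F u (k - fun i => (W₁.phase j).m i * n) t +
              (starRingEnd ℂ (Complex.exp ((W₁.phase j).φ * Complex.I)) *
                  (-(1 / (2 * ((2 * Real.pi * ‖latticeVec (W₁.phase j).m‖ : ℝ) : ℂ) * Complex.I)))) •
                modeRep W₁ n 𝔹 F u (k + fun i => (W₁.phase j).m i * n) t))⟫_ℂ).re) t ∧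
      -(2 * Q t) - ∑ k ∈ W, 2 * (⟪modeRep W₁ n 𝔹 F u k t,
          (-(((4 * Real.pi ^ 2 : ℝ) : ℂ) • transversalProj k (Torus.symbT (Torus.majorTranspose 𝔹) k (modeRep W₁ n 𝔹 F u k t))) -
          ∑ j, linkCoeff W₁ n k j t • transversalProj k
            ((Complex.exp ((W₁.phase j).φ * Complex.I) * (1 / (2 * ((2 * Real.pi * ‖latticeVec (W₁.phase j).m‖ : ℝ) : ℂ) * Complex.I))) •
                modeRep W₁ n 𝔹 F u (k - fun i => (W₁.phase j).m i * n) t +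
              (starRingEnd ℂ (Complex.exp ((W₁.phase j).φ * Complex.I)) *
                  (-(1 / (2 * ((2 * Real.pi * ‖latticeVec (W₁.phase j).m‖ : ℝ) : ℂ) * Complex.I)))) •
                modeRep W₁ n 𝔹 F u (k + fun i => (W₁.phase j).m i * n) t))⟫_ℂ).re
        ≤ -(dmin * (E t - ∑ k ∈ W, ‖modeRep W₁ n 𝔹 F u k t‖ ^ 2)) +
          ∑ k ∈ W, 2 * (⟪modeRep W₁ n 𝔹 F u k t,
            ∑ j, linkCoeff W₁ n k j t • transversalProj k
              ((Complex.exp ((W₁.phase j).φ * Complex.I) * (1 / (2 * ((2 * Real.pi * ‖latticeVec (W₁.phase j).m‖ : ℝ) : ℂ) * Complex.I))) •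
                  modeRep W₁ n 𝔹 F u (k - fun i => (W₁.phase j).m i * n) t +
                (starRingEnd ℂ (Complex.exp ((W₁.phase j).φ * Complex.I)) *
                    (-(1 / (2 * ((2 * Real.pi * ‖latticeVec (W₁.phase j).m‖ : ℝ) : ℂ) * Complex.I)))) •
                  modeRep W₁ n 𝔹 F u (k + fun i => (W₁.phase j).m i * n) t)⟫_ℂ).re := by
  classical
  have hrep := (ae_restrict_iff' measurableSet_Ioo).1 (ae_forall_eq_modeRep W₁ n hT h hF)
  have hE' := (ae_restrict_iff' measurableSet_Ioo).1 hE
  have hQ' := (ae_restrict_iff' measurableSet_Ioo).1 hQ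
  have hgap' := (ae_restrict_iff' measurableSet_Ioo).1 hgap
  have hmem := (ae_restrict_iff' measurableSet_Ioo).1 h.ae_memLp_two
  filter_upwards [hrep, hE', hQ', hgap', hmem, hEd] with t hrept hEt hQt hgapt hmemt hEdt htI
  -- notation at time `t`
  set X : (Fin 3 → ℤ) → EuclideanSpace ℂ (Fin 3) := fun k => modeRep W₁ n 𝔹 F u k t with hX
  set L : (Fin 3 → ℤ) → EuclideanSpace ℂ (Fin 3) := fun k => ∑ j, linkCoeff W₁ n k j t • transversalProj k
      ((Complex.exp ((W₁.phase j).φ * Complex.I) * (1 / (2 * ((2 * Real.pi * ‖latticeVec (W₁.phase j).m‖ : ℝ) : ℂ) * Complex.I))) •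
          modeRep W₁ n 𝔹 F u (k - fun i => (W₁.phase j).m i * n) t +
        (starRingEnd ℂ (Complex.exp ((W₁.phase j).φ * Complex.I)) *
            (-(1 / (2 * ((2 * Real.pi * ‖latticeVec (W₁.phase j).m‖ : ℝ) : ℂ) * Complex.I)))) •
          modeRep W₁ n 𝔹 F u (k + fun i => (W₁.phase j).m i * n) t) with hL
  refine ⟨?_, ?_⟩
  · -- the derivative: `E' = −2Q` and the classical derivatives of the slow amplitudes
    have hsum := HasDerivAt.fun_sum (u := W) fun k _ => hasDerivAt_norm_sq_modeRep W₁ n h hF k htI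
    exact (hEdt htI).sub hsum
  · -- the bound: block split at `W`
    have hrept' := hrept htI
    have hkdot : ∀ k, kdot k (X k) = 0 := fun k => kdot_modeRep W₁ n hT h k (Ioo_subset_Icc_self htI)
    have hpars : HasSum (fun k => ‖X k‖ ^ 2) (E t) := by
      have hp := hasSum_sq_norm_mFourierCoeff_complexify (hmemt htI)
      rw [hEt htI]
      refine hp.congr_fun fun k => ?_
      simp only [hX, hrept' k]
    have hblock : ∀ S : Finset (Fin 3 → ℤ), 4 * Real.pi ^ 2 * ∑ k ∈ S, (⟪X k, Torus.symbT 𝔹 k (X k)⟫_ℂ).re ≤ Q t := by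
      intro S
      have := hQt htI S
      simpa only [hX, hrept'] using this
    have hcoer : ∀ k, lo' * (freqNormSq k * ‖X k‖ ^ 2) ≤ (⟪X k, Torus.symbT 𝔹 k (X k)⟫_ℂ).re :=
      fun k => Torus.lo_mul_le_re_inner_symbT h𝔹 (hkdot k)
    have hgap'' : ∀ k, k ∉ W → X k ≠ 0 → dmin ≤ 8 * Real.pi ^ 2 * lo' * freqNormSq k := by
      intro k hk hXk
      refine hgapt htI k hk ?_
      rw [hrept' k]; exact hXk
    have hsplit := block_split_le hdmin hpars hblock hcoer W hgap''
    -- the viscous part of `Re⟪y_k, rhs_k⟫`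
    have hvisc : ∀ k, (⟪X k, -(((4 * Real.pi ^ 2 : ℝ) : ℂ) • transversalProj k (Torus.symbT (Torus.majorTranspose 𝔹) k (X k))) - L k⟫_ℂ).re
        = -(4 * Real.pi ^ 2 * (⟪X k, Torus.symbT 𝔹 k (X k)⟫_ℂ).re) - (⟪X k, L k⟫_ℂ).re := by
      intro k
      have hTT : (⟪X k, Torus.symbT (Torus.majorTranspose 𝔹) k (X k)⟫_ℂ).re = (⟪X k, Torus.symbT 𝔹 k (X k)⟫_ℂ).re := by
        rw [← inner_conj_symm, Torus.inner_symbT_majorTranspose_left, Complex.conj_re]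
      rw [inner_sub_right, inner_neg_right, inner_smul_right, inner_transversalProj_right_of_kdot_eq_zero k (hkdot k),
        Complex.sub_re, Complex.neg_re, Complex.re_ofReal_mul, hTT]
    have hterm : ∀ k ∈ W, 2 * (⟪X k, -(((4 * Real.pi ^ 2 : ℝ) : ℂ) • transversalProj k (Torus.symbT (Torus.majorTranspose 𝔹) k (X k))) - L k⟫_ℂ).re
        = -(2 * (4 * Real.pi ^ 2 * (⟪X k, Torus.symbT 𝔹 k (X k)⟫_ℂ).re)) - 2 * (⟪X k, L k⟫_ℂ).re := by
      intro k _; rw [hvisc k]; ring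
    rw [Finset.sum_congr rfl hterm, Finset.sum_sub_distrib, Finset.sum_neg_distrib, ← Finset.mul_sum, ← Finset.mul_sum]
    have hZ := hsplit
    nlinarith [hZ, Finset.sum_nonneg fun k (_ : k ∈ W) => sq_nonneg ‖X k‖]


/-! ## §3 Integration: the fast energy under an exchange bound -/

/-- **Forced decay of the fast energy.**  If the exchange is a.e. `≤ (dmin/2)·Z + G`, then for every `t ∈ [0,T]`:
`Z t ≤ 2G/dmin + e^{−dmin·t/2}·(Z 0 − 2G/dmin)`, `Z = E − Σ_{k∈W}‖y_k‖²`. [cite: BedrossianCotiZelati2017, §2] [cite: Temam1984, Ch. III §1 Lemma 1.2] -/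
theorem fastEnergy_le_of_exchange_le (W₁ : LatticeWord k₀) (n : ℕ) {T : ℝ} (hT : 0 ≤ T) {𝔹 : Torus.Visc4 (Fin 3)} {lo' hi' : ℝ}
    (h𝔹 : Torus.NearIso 𝔹 lo' hi')
    {F : UnitAddTorus (Fin 3) → EuclideanSpace ℝ (Fin 3)} {u : ℝ → UnitAddTorus (Fin 3) → EuclideanSpace ℝ (Fin 3)}
    (h : Torus.IsWeakTensorPassiveVectorOn 0 T 𝔹 (W₁.cell n) F u) (hF : Integrable F volume)
    {E Q : ℝ → ℝ} (hE : ∀ᵐ t ∂(volume.restrict (Ioo 0 T)), E t = ∫ x, ‖u t x‖ ^ 2)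
    (hQ : ∀ᵐ t ∂(volume.restrict (Ioo 0 T)), ∀ S : Finset (Fin 3 → ℤ),
      4 * Real.pi ^ 2 * ∑ k ∈ S, (⟪mFourierCoeff (EuclideanSpace.complexify ∘ u t) k,
        Torus.symbT 𝔹 k (mFourierCoeff (EuclideanSpace.complexify ∘ u t) k)⟫_ℂ).re ≤ Q t)
    (hEd : ∀ᵐ t ∂(volume : Measure ℝ), t ∈ Ioo 0 T → HasDerivAt E (-(2 * Q t)) t)
    (hEac : ∀ a ∈ Icc 0 T, ∀ b' ∈ Icc 0 T, AbsolutelyContinuousOnInterval E a b')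
    (W : Finset (Fin 3 → ℤ)) {dmin : ℝ} (hdmin : 0 < dmin)
    (hgap : ∀ᵐ t ∂(volume.restrict (Ioo 0 T)), ∀ k : Fin 3 → ℤ, k ∉ W →
      mFourierCoeff (EuclideanSpace.complexify ∘ u t) k ≠ 0 → dmin ≤ 8 * Real.pi ^ 2 * lo' * freqNormSq k)
    {G : ℝ} (hX : ∀ᵐ t ∂(volume : Measure ℝ), t ∈ Ioo 0 T →
      ∑ k ∈ W, 2 * (⟪modeRep W₁ n 𝔹 F u k t, (∑ j, linkCoeff W₁ n k j t • transversalProj k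
              ((Complex.exp ((W₁.phase j).φ * Complex.I) * (1 / (2 * ((2 * Real.pi * ‖latticeVec (W₁.phase j).m‖ : ℝ) : ℂ) * Complex.I))) •
                  modeRep W₁ n 𝔹 F u (k - fun i => (W₁.phase j).m i * n) t +
                (starRingEnd ℂ (Complex.exp ((W₁.phase j).φ * Complex.I)) *
                    (-(1 / (2 * ((2 * Real.pi * ‖latticeVec (W₁.phase j).m‖ : ℝ) : ℂ) * Complex.I)))) •
                  modeRep W₁ n 𝔹 F u (k + fun i => (W₁.phase j).m i * n) t))⟫_ℂ).re
        ≤ dmin / 2 * (E t - ∑ k ∈ W, ‖modeRep W₁ n 𝔹 F u k t‖ ^ 2) + G)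
    {t : ℝ} (ht : t ∈ Icc 0 T) :
    E t - ∑ k ∈ W, ‖modeRep W₁ n 𝔹 F u k t‖ ^ 2 ≤
      2 * G / dmin + Real.exp (-(dmin / 2 * t)) * ((E 0 - ∑ k ∈ W, ‖modeRep W₁ n 𝔹 F u k 0‖ ^ 2) - 2 * G / dmin) := by
  classical
  have h0 : (0:ℝ) ∈ Icc 0 T := ⟨le_rfl, hT⟩
  -- absolute continuity of `Z` on `[0,t]`
  have hZac : AbsolutelyContinuousOnInterval (fun s => E s - ∑ k ∈ W, ‖modeRep W₁ n 𝔹 F u k s‖ ^ 2) 0 t :=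
    (hEac 0 h0 t ht).fun_sub (absolutelyContinuousOnInterval_finsetSum W fun k _ =>
      (absolutelyContinuousOnInterval_modeRep W₁ n hT h k h0 ht).norm_sq)
  -- the a.e. derivative and its bound, on `uIcc 0 t`
  have hae := ae_hasDerivAt_fastEnergy_le W₁ n hT h𝔹 h hF hE hQ hEd W hdmin.le hgap
  have hae' := ae_uIcc_of_ae_Ioo (P := fun s =>
      (HasDerivAt (fun s => E s - ∑ k ∈ W, ‖modeRep W₁ n 𝔹 F u k s‖ ^ 2)
        (-(2 * Q s) - ∑ k ∈ W, 2 * (⟪modeRep W₁ n 𝔹 F u k s, (-(((4 * Real.pi ^ 2 : ℝ) : ℂ) • transversalProj k (Torus.symbT (Torus.majorTranspose 𝔹) k (modeRep W₁ n 𝔹 F u k s))) -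
          ∑ j, linkCoeff W₁ n k j s • transversalProj k
            ((Complex.exp ((W₁.phase j).φ * Complex.I) * (1 / (2 * ((2 * Real.pi * ‖latticeVec (W₁.phase j).m‖ : ℝ) : ℂ) * Complex.I))) •
                modeRep W₁ n 𝔹 F u (k - fun i => (W₁.phase j).m i * n) s +
              (starRingEnd ℂ (Complex.exp ((W₁.phase j).φ * Complex.I)) *
                  (-(1 / (2 * ((2 * Real.pi * ‖latticeVec (W₁.phase j).m‖ : ℝ) : ℂ) * Complex.I)))) •
                modeRep W₁ n 𝔹 F u (k + fun i => (W₁.phase j).m i * n) s))⟫_ℂ).re) s ∧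
      -(2 * Q s) - ∑ k ∈ W, 2 * (⟪modeRep W₁ n 𝔹 F u k s, (-(((4 * Real.pi ^ 2 : ℝ) : ℂ) • transversalProj k (Torus.symbT (Torus.majorTranspose 𝔹) k (modeRep W₁ n 𝔹 F u k s))) -
          ∑ j, linkCoeff W₁ n k j s • transversalProj k
            ((Complex.exp ((W₁.phase j).φ * Complex.I) * (1 / (2 * ((2 * Real.pi * ‖latticeVec (W₁.phase j).m‖ : ℝ) : ℂ) * Complex.I))) •
                modeRep W₁ n 𝔹 F u (k - fun i => (W₁.phase j).m i * n) s +
              (starRingEnd ℂ (Complex.exp ((W₁.phase j).φ * Complex.I)) *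
                  (-(1 / (2 * ((2 * Real.pi * ‖latticeVec (W₁.phase j).m‖ : ℝ) : ℂ) * Complex.I)))) •
                modeRep W₁ n 𝔹 F u (k + fun i => (W₁.phase j).m i * n) s))⟫_ℂ).re
        ≤ -(dmin * (E s - ∑ k ∈ W, ‖modeRep W₁ n 𝔹 F u k s‖ ^ 2)) +
          ∑ k ∈ W, 2 * (⟪modeRep W₁ n 𝔹 F u k s, (∑ j, linkCoeff W₁ n k j s • transversalProj k
              ((Complex.exp ((W₁.phase j).φ * Complex.I) * (1 / (2 * ((2 * Real.pi * ‖latticeVec (W₁.phase j).m‖ : ℝ) : ℂ) * Complex.I))) •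
                  modeRep W₁ n 𝔹 F u (k - fun i => (W₁.phase j).m i * n) s +
                (starRingEnd ℂ (Complex.exp ((W₁.phase j).φ * Complex.I)) *
                    (-(1 / (2 * ((2 * Real.pi * ‖latticeVec (W₁.phase j).m‖ : ℝ) : ℂ) * Complex.I)))) •
                  modeRep W₁ n 𝔹 F u (k + fun i => (W₁.phase j).m i * n) s))⟫_ℂ).re) ∧
      (∑ k ∈ W, 2 * (⟪modeRep W₁ n 𝔹 F u k s, (∑ j, linkCoeff W₁ n k j s • transversalProj k
              ((Complex.exp ((W₁.phase j).φ * Complex.I) * (1 / (2 * ((2 * Real.pi * ‖latticeVec (W₁.phase j).m‖ : ℝ) : ℂ) * Complex.I))) •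
                  modeRep W₁ n 𝔹 F u (k - fun i => (W₁.phase j).m i * n) s +
                (starRingEnd ℂ (Complex.exp ((W₁.phase j).φ * Complex.I)) *
                    (-(1 / (2 * ((2 * Real.pi * ‖latticeVec (W₁.phase j).m‖ : ℝ) : ℂ) * Complex.I)))) •
                  modeRep W₁ n 𝔹 F u (k + fun i => (W₁.phase j).m i * n) s))⟫_ℂ).re
        ≤ dmin / 2 * (E s - ∑ k ∈ W, ‖modeRep W₁ n 𝔹 F u k s‖ ^ 2) + G))
    le_rfl ht.1 ht.2 ((ae_restrict_iff' measurableSet_Ioo).2 (by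
      filter_upwards [hae, hX] with s hs hXs hsI
      exact ⟨hs hsI, hXs hsI⟩))
  have hderiv : ∀ᵐ s ∂(volume : Measure ℝ), s ∈ uIcc 0 t →
      HasDerivAt (fun s => E s - ∑ k ∈ W, ‖modeRep W₁ n 𝔹 F u k s‖ ^ 2)
        (-(2 * Q s) - ∑ k ∈ W, 2 * (⟪modeRep W₁ n 𝔹 F u k s, (-(((4 * Real.pi ^ 2 : ℝ) : ℂ) • transversalProj k (Torus.symbT (Torus.majorTranspose 𝔹) k (modeRep W₁ n 𝔹 F u k s))) -
          ∑ j, linkCoeff W₁ n k j s • transversalProj k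
            ((Complex.exp ((W₁.phase j).φ * Complex.I) * (1 / (2 * ((2 * Real.pi * ‖latticeVec (W₁.phase j).m‖ : ℝ) : ℂ) * Complex.I))) •
                modeRep W₁ n 𝔹 F u (k - fun i => (W₁.phase j).m i * n) s +
              (starRingEnd ℂ (Complex.exp ((W₁.phase j).φ * Complex.I)) *
                  (-(1 / (2 * ((2 * Real.pi * ‖latticeVec (W₁.phase j).m‖ : ℝ) : ℂ) * Complex.I)))) •
                modeRep W₁ n 𝔹 F u (k + fun i => (W₁.phase j).m i * n) s))⟫_ℂ).re) s := by
    filter_upwards [hae'] with s hs hsI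
    exact (hs hsI).1.1
  have hineq : ∀ᵐ s ∂(volume : Measure ℝ), s ∈ uIcc 0 t →
      -(2 * Q s) - ∑ k ∈ W, 2 * (⟪modeRep W₁ n 𝔹 F u k s, (-(((4 * Real.pi ^ 2 : ℝ) : ℂ) • transversalProj k (Torus.symbT (Torus.majorTranspose 𝔹) k (modeRep W₁ n 𝔹 F u k s))) -
          ∑ j, linkCoeff W₁ n k j s • transversalProj k
            ((Complex.exp ((W₁.phase j).φ * Complex.I) * (1 / (2 * ((2 * Real.pi * ‖latticeVec (W₁.phase j).m‖ : ℝ) : ℂ) * Complex.I))) •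
                modeRep W₁ n 𝔹 F u (k - fun i => (W₁.phase j).m i * n) s +
              (starRingEnd ℂ (Complex.exp ((W₁.phase j).φ * Complex.I)) *
                  (-(1 / (2 * ((2 * Real.pi * ‖latticeVec (W₁.phase j).m‖ : ℝ) : ℂ) * Complex.I)))) •
                modeRep W₁ n 𝔹 F u (k + fun i => (W₁.phase j).m i * n) s))⟫_ℂ).re
        ≤ -(dmin / 2) * (E s - ∑ k ∈ W, ‖modeRep W₁ n 𝔹 F u k s‖ ^ 2) + G := by
    filter_upwards [hae'] with s hs hsI
    have h1 := (hs hsI).1.2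
    have h2 := (hs hsI).2
    linarith
  have key := gronwall_ac_forced (σ := dmin / 2) (G := G) ht.1 (by positivity) hZac hderiv hineq
  have h1 : G / (dmin / 2) = 2 * G / dmin := by field_simp
  have h2 : -(dmin / 2 * (t - 0)) = -(dmin / 2 * t) := by ring
  rw [h1, h2] at key
  exact key

end Summit.AnomalousDissipation.AnomalousDissipation.Theorems.SolenoidalFractalHomogenisation.LagrangianStep.CellChain

end
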